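import Summits.CriticalPhenomena.PercolationContinuityZ3.Theorems.Transplant.SkelPhiQStepsN
import Summits.CriticalPhenomena.PercolationContinuityZ3.Theorems.Transplant.PlanarSkeletonFrmQuasiDefs
import HarnessLib

/-!
# WAVE-Q small helper (quasi-step rung (N3-b); lane `prim-bschramm`, seat `prim-bschramm-stmt` gen 33): **THE COST OF A QUASI-STEP IS AT LEAST ONE** —
# `Skelφ.QStepsN.one_le : QStepsN G F N → (w : V) → 1 ≤ N` and `PlanarSkeletonFrmQuasi.one_le_M : (Φ : PlanarSkeletonFrmQuasi G) → (v : V) → 1 ≤ Φ.M`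

builds on p205010 (kernel theorem, internal audit signed; external expert review pending) — nothing in this file uses p205010; nothing here is a claim about any open node.
Helper file (`--supports stmt-CriticalPhenomena-4575 --as helper`); def-free.
WHY.  Several WAVE-Q rows take a hypothesis `hM : 1 ≤ M` on the quasi-step cost (this seat's radius converters `Skelφ.FloorsX2VQ.of_floorsX2V` /
`FloorsY2VQ.of_floorsY2V` p514694/p514188, `KS0.hr₀_kit0N`, `KS0.T0N_lt_R'0N`, hp-8's `KS.T₀aN_lt_RAN'`), and hp-8's «SkelFrmQuasiBParamsKitSN» spelled the cost of record
`NQ Φ := 13 · max Φ.M 1` only to avoid this lemma.  It is immediate: a quasi-step from `w` realises the unit move `F w ↦ F w + e₀` by a walk of length `≤ N` whose far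
end `w′` has `F w′ ≠ F w`, hence `w′ ≠ w`, hence the walk has positive length.  For the carrier, any vertex `v` witnesses it (`Φ.qstep.one_le v`).
[cite: KozmaNitzan2024, §4 p. 26 ((29))] [this work]
-/

namespace Summit.CriticalPhenomena.PercolationContinuityZ3.Theorems.Transplant

open Literature.Probability.Percolation Literature.Probability.LatticeModels SimpleGraph

namespace Skelφ

variable {V : Type} {G : SimpleGraph V} {F : V → Site 2}

/-- **A quasi-step has positive cost**: if every unit move of `F` is realised by a walk of length `≤ N` (`QStepsN G F N`) and the graph has a vertex `w`, then
`1 ≤ N` — the far end of the link realising `F w ↦ F w + e₀` differs from `w`. [folklore] -/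
theorem QStepsN.one_le {N : ℕ} (hq : QStepsN G F N) (w : V) : 1 ≤ N := by
  obtain ⟨w', hF, p, hp, -⟩ := hq w 0 1
  have hne : w ≠ w' := by
    rintro rfl
    have h := congrFun hF 0
    simp at h
  by_contra hN
  have h0 : p.length = 0 := by omega
  exact hne (SimpleGraph.Walk.eq_of_length_eq_zero h0)

end Skelφ

namespace PlanarSkeletonFrmQuasi

variable {V : Type} {G : SimpleGraph V} [G.LocallyFinite]

/-- **The quasi-step cost of a frames-only quasi-step skeleton is at least one** (at any vertex `v`). [folklore] -/
theorem one_le_M (Φ : PlanarSkeletonFrmQuasi G) (v : V) : 1 ≤ Φ.M := Φ.qstep.one_le v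

/-- `max Φ.M 1 = Φ.M` (so hp-8's cost of record `KS.NQ Φ = 13 · max Φ.M 1` is `13 · Φ.M`), given a vertex. [folklore] -/
theorem max_M_one (Φ : PlanarSkeletonFrmQuasi G) (v : V) : max Φ.M 1 = Φ.M := max_eq_left (Φ.one_le_M v)

end PlanarSkeletonFrmQuasi

end Summit.CriticalPhenomena.PercolationContinuityZ3.Theorems.Transplant
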